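import Mathlib.Logic.Equiv.Fin.Basic
import Literature.Computability.Cryptography.LWERegevTransforms
import Literature.Computability.Cryptography.LWESampling
import Literature.Computability.Cryptography.LWESearchToDecisionTest
import Literature.Probability.Distributions.FiniteProductLaws
import HarnessLib

/-!
# Product laws for iid tuples of LWE samples: pairs, splitting, regrouping, projections

Topic `Computability/Cryptography` (LWE), grouping namespace `LWE` (the model of
`Literature/Computability/Cryptography/LWE.lean`: the `m`-fold iid product `iidPMF p m` of a `PMF`).
The analysis of Regev's search-to-decision reduction (`regev_decision_to_search`, `LWEHardness.lean`;
Regev 2009, §4, Lemmas 4.1–4.2) draws ONE tuple of `m'` independent samples from `A_{s,χ}` and uses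
disjoint blocks of it for different purposes (shift vectors `t`, fresh scalars `l`, blocks fed to the
distinguisher, self-made uniform samples). Its probability estimates rest on the elementary
independence structure of an iid tuple, which this file proves once, in `PMF` form:

* for the independent-pair law `prodLaw P Q` of `Literature/Probability/Distributions/FiniteProductLaws.lean`
  (`pairLaw P = prodLaw U_R P`): push-forward along `Prod.swap` / `Prod.map`, the mass of a set as an
  iterated sum, the **two-stage bound** `toOuterMeasure_prodLaw_le` (if every section
  `{b | (a, b) ∈ E}` has `Q`-mass `≤ δ` then `E` has mass `≤ δ`) and the mass of a product set;
* `iidPMF_map_appendEquiv_symm` — the first `a` and the last `b` samples of an iid `(a+b)`-tuple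
  (`(Fin.appendEquiv a b).symm`) form an independent pair of iid tuples; `iidPMF_map_blocksOf` — an iid `(K·u)`-tuple regrouped into `K`
  consecutive blocks of `u` is an iid `K`-tuple of iid `u`-tuples; `iidPMF_map_eval` — every
  coordinate has law `p`; `prodLaw_iidPMF_map_zip` — zipping two independent iid tuples gives an iid
  tuple of independent pairs;
* `toOuterMeasure_iidPMF_forall` — `Pr[∀ r, vᵣ ∈ A] = Pr[A]^R` for an iid tuple; the complement
  bound `one_sub_le_toOuterMeasure_of_compl_le` (via `toOuterMeasure_add_compl` of
  `LWESearchToDecisionTest.lean`, imported for that lemma only);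
* uniform laws: `prodLaw_uniformOfFintype`, `uniformOfFintype_map_fst/snd`,
  `uniformOfFintype_pi_map_eval` (a coordinate of a uniform vector is uniform), and for LWE
  `lweSample_map_fst_eval` (a coordinate of the `a`-part of `A_{s,χ}` is uniform in `ℤ_q`).

All statements are exact identities of `PMF`s (no asymptotics); proofs are mass computations
(`iidPMF_apply'`, `Fintype.prod_equiv`) or `bind`/`map` algebra.

## References

* O. Regev, *On lattices, learning with errors, random linear codes, and cryptography*, J. ACM 56
  (2009), art. 34, §2 ("`m` independent samples from `A_{s,χ}`"; the `a` are "chosen uniformly"),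
  §4, proofs of Lemmas 4.1–4.2 (fresh uniform `t ∈ ℤ_pⁿ`, `l ∈ ℤ_p`). [cite: RegevLWE2009, §2, §4]
-/

noncomputable section

open scoped ENNReal

namespace Literature.Computability.Cryptography

namespace LWE

open Literature.Probability.Distributions

/-! ### Independent pairs -/

section Prod

variable {α β γ δ : Type}

/-- Regev's `pairLaw P` of `LWERegevTransforms.lean` is `prodLaw U_R P` (definitional). [folklore] -/
theorem pairLaw_eq_prodLaw {ι R : Type} [CommRing R] [Fintype R] (P : PMF ((ι → R) × R)) :
    pairLaw P = prodLaw (PMF.uniformOfFintype R) P :=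
  rfl

/-- Mass formula, point form. [folklore] -/
theorem prodLaw_apply' (P : PMF α) (Q : PMF β) (x : α × β) : prodLaw P Q x = P x.1 * Q x.2 :=
  prodLaw_apply P Q x.1 x.2

/-- Swapping an independent pair. [folklore] -/
theorem prodLaw_map_swap (P : PMF α) (Q : PMF β) : (prodLaw P Q).map Prod.swap = prodLaw Q P := by
  ext ⟨b, a⟩
  rw [show ((b, a) : β × α) = Prod.swap (a, b) from rfl,
    pmf_map_apply_of_injective _ Prod.swap_injective, prodLaw_apply, prodLaw_apply', Prod.fst_swap,
    Prod.snd_swap, mul_comm]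

/-- Push-forward of an independent pair along a product map is the independent pair of the
push-forwards. [folklore] -/
theorem prodLaw_map_prodMap (P : PMF α) (Q : PMF β) (f : α → γ) (g : β → δ) :
    (prodLaw P Q).map (Prod.map f g) = prodLaw (P.map f) (Q.map g) := by
  rw [prodLaw, prodLaw, PMF.map_bind, PMF.bind_map]
  refine congrArg _ (funext fun a => ?_)
  rw [PMF.map_comp, Function.comp_apply, PMF.map_comp]
  rfl

/-- The mass of a set under an independent pair, as an iterated sum over sections. [folklore] -/
theorem toOuterMeasure_prodLaw_eq_tsum (P : PMF α) (Q : PMF β) (E : Set (α × β)) :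
    (prodLaw P Q).toOuterMeasure E = ∑' a, P a * Q.toOuterMeasure (Prod.mk a ⁻¹' E) := by
  rw [prodLaw, PMF.toOuterMeasure_bind_apply]
  refine tsum_congr fun a => ?_
  rw [PMF.toOuterMeasure_map_apply]

/-- **Two-stage bound**: if every section of `E` has `Q`-mass at most `δ`, then `E` has mass at most
`δ` under the independent pair. [folklore] -/
theorem toOuterMeasure_prodLaw_le (P : PMF α) (Q : PMF β) (E : Set (α × β)) {δ : ℝ≥0∞}
    (h : ∀ a, Q.toOuterMeasure (Prod.mk a ⁻¹' E) ≤ δ) : (prodLaw P Q).toOuterMeasure E ≤ δ := by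
  rw [toOuterMeasure_prodLaw_eq_tsum]
  calc ∑' a, P a * Q.toOuterMeasure (Prod.mk a ⁻¹' E) ≤ ∑' a, P a * δ := by
        exact ENNReal.tsum_le_tsum fun a => by gcongr; exact h a
    _ = δ := by rw [ENNReal.tsum_mul_right, PMF.tsum_coe, one_mul]

/-- The mass of a product set under an independent pair is the product of the masses. [folklore] -/
theorem toOuterMeasure_prodLaw_prod (P : PMF α) (Q : PMF β) (A : Set α) (B : Set β) :
    (prodLaw P Q).toOuterMeasure (A ×ˢ B) = P.toOuterMeasure A * Q.toOuterMeasure B := by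
  classical
  rw [toOuterMeasure_prodLaw_eq_tsum, PMF.toOuterMeasure_apply P A, ← ENNReal.tsum_mul_right]
  refine tsum_congr fun a => ?_
  by_cases ha : a ∈ A
  · rw [Set.indicator_of_mem ha, show Prod.mk a ⁻¹' A ×ˢ B = B from Set.ext fun b => by simp [ha]]
  · rw [Set.indicator_of_notMem ha, zero_mul,
      show Prod.mk a ⁻¹' A ×ˢ B = ∅ from Set.ext fun b => by simp [ha], MeasureTheory.measure_empty,
      mul_zero]

/-- `Pr[s] = 1 - Pr[sᶜ]` (from `toOuterMeasure_add_compl` of `LWESearchToDecisionTest.lean`; a twin of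
`Literature.Barriers.PneNP.toOuterMeasure_eq_one_sub_compl` in another cone). [folklore] -/
theorem one_sub_toOuterMeasure_compl (p : PMF α) (s : Set α) : 1 - p.toOuterMeasure sᶜ = p.toOuterMeasure s := by
  have h : p.toOuterMeasure sᶜ ≠ ⊤ :=
    ne_top_of_le_ne_top ENNReal.one_ne_top (le_add_self.trans_eq (toOuterMeasure_add_compl p s))
  rw [← toOuterMeasure_add_compl p s, ENNReal.add_sub_cancel_right h]

/-- **Complement bound**: if the failure set has mass `≤ δ` then its complement has mass `≥ 1 - δ`.
[folklore] -/
theorem one_sub_le_toOuterMeasure_of_compl_le (p : PMF α) (s : Set α) {δ : ℝ≥0∞}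
    (h : p.toOuterMeasure sᶜ ≤ δ) : 1 - δ ≤ p.toOuterMeasure s := by
  rw [← one_sub_toOuterMeasure_compl]
  exact tsub_le_tsub_left h 1

end Prod

/-! ### Splitting, regrouping, projecting and zipping iid tuples -/

section Tuples

variable {α β : Type}

/-- **Two blocks of an iid tuple are independent iid tuples**: splitting `p^{⊗(a+b)}` into its first
`a` and last `b` samples (Mathlib's `(Fin.appendEquiv a b).symm`) gives the law `p^{⊗a} ⊗ p^{⊗b}`.
[cite: RegevLWE2009, §2 (independent samples)] -/
theorem iidPMF_map_appendEquiv_symm (p : PMF α) (a b : ℕ) :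
    (iidPMF p (a + b)).map (Fin.appendEquiv a b).symm = prodLaw (iidPMF p a) (iidPMF p b) := by
  ext ⟨v₁, v₂⟩
  rw [pmf_map_equiv_apply, Equiv.symm_symm]
  show iidPMF p (a + b) (Fin.append v₁ v₂) = _
  rw [prodLaw_apply, iidPMF_append]

/-- Regrouping a `(K·u)`-tuple into `K` consecutive blocks of `u` samples: block `g`, position
`j` is the sample of index `g·u + j` (`finProdFinEquiv (g, j)`). [folklore] -/
def blocksOf (K u : ℕ) (S : Fin (K * u) → α) : Fin K → Fin u → α :=
  fun g j => S (finProdFinEquiv (g, j))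

/-- The flat index of block `g`, position `j` is `g·u + j`. [folklore] -/
theorem val_finProdFinEquiv (K u : ℕ) (g : Fin K) (j : Fin u) :
    (finProdFinEquiv (g, j) : Fin (K * u)).val = g.val * u + j.val := by
  rw [finProdFinEquiv_apply_val]
  ring

/-- Inverse of `blocksOf`. [folklore] -/
def unblocks (K u : ℕ) (w : Fin K → Fin u → α) : Fin (K * u) → α :=
  fun i => w (finProdFinEquiv.symm i).1 (finProdFinEquiv.symm i).2

/-- `blocksOf ∘ unblocks = id`. [folklore] -/
@[simp] theorem blocksOf_unblocks (K u : ℕ) (w : Fin K → Fin u → α) : blocksOf K u (unblocks K u w) = w := by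
  funext g j
  simp [blocksOf, unblocks]

/-- `unblocks ∘ blocksOf = id`. [folklore] -/
@[simp] theorem unblocks_blocksOf (K u : ℕ) (S : Fin (K * u) → α) : unblocks K u (blocksOf K u S) = S := by
  funext i
  show S (finProdFinEquiv (finProdFinEquiv.symm i)) = S i
  rw [Equiv.apply_symm_apply]

/-- `blocksOf` is injective. [folklore] -/
theorem blocksOf_injective (K u : ℕ) : Function.Injective (blocksOf (α := α) K u) :=
  Function.LeftInverse.injective (unblocks_blocksOf K u)

/-- **Regrouping an iid tuple**: `K` consecutive blocks of `u` samples of `p^{⊗(K·u)}` form an iid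
`K`-tuple of iid `u`-tuples, `(p^{⊗u})^{⊗K}`. [cite: RegevLWE2009, §2 (independent samples)] -/
theorem iidPMF_map_blocksOf (p : PMF α) (K u : ℕ) :
    (iidPMF p (K * u)).map (blocksOf K u) = iidPMF (iidPMF p u) K := by
  ext w
  rw [← blocksOf_unblocks K u w, pmf_map_apply_of_injective _ (blocksOf_injective K u), blocksOf_unblocks,
    iidPMF_apply', iidPMF_apply']
  simp_rw [iidPMF_apply']
  rw [← Fintype.prod_prod_type' (f := fun g j => p (w g j))]
  exact Fintype.prod_equiv finProdFinEquiv.symm _ _ fun i => rfl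

/-- **Every coordinate of an iid tuple has law `p`.** [cite: RegevLWE2009, §2 (independent samples)] -/
theorem iidPMF_map_eval (p : PMF α) : ∀ (I : ℕ) (i : Fin I), (iidPMF p I).map (fun v => v i) = p
  | 0, i => i.elim0
  | I + 1, i => by
    refine Fin.cases ?_ (fun j => ?_) i
    · rw [iidPMF_succ, PMF.map_bind]
      have h : ∀ x : α, ((iidPMF p I).map fun v => Fin.cons x v).map (fun v : Fin (I + 1) → α => v 0) =
          PMF.pure x := fun x => by
        rw [PMF.map_comp,
          show (fun v : Fin (I + 1) → α => v 0) ∘ (fun v : Fin I → α => (Fin.cons x v : Fin (I + 1) → α)) =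
            Function.const _ x from funext fun v => by simp]
        exact PMF.map_const _ x
      simp_rw [h]
      exact PMF.bind_pure p
    · rw [iidPMF_succ, PMF.map_bind]
      have h : ∀ x : α, ((iidPMF p I).map fun v => Fin.cons x v).map (fun v : Fin (I + 1) → α => v j.succ) =
          p := fun x => by
        rw [PMF.map_comp,
          show (fun v : Fin (I + 1) → α => v j.succ) ∘ (fun v : Fin I → α => (Fin.cons x v : Fin (I + 1) → α)) =
            fun v => v j from funext fun v => by simp]
        exact iidPMF_map_eval p I j
      simp_rw [h]
      exact PMF.bind_const p p

/-- **Zipping two independent iid tuples** (Mathlib's `(Equiv.arrowProdEquivProdArrow …).symm`) gives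
an iid tuple of independent pairs: `(P^{⊗m} ⊗ Q^{⊗m}).map zip = (P ⊗ Q)^{⊗m}`. [cite: RegevLWE2009, §4 (proof of Lemma 4.2: a fresh uniform `l` per sample)] -/
theorem prodLaw_iidPMF_map_zip (P : PMF α) (Q : PMF β) (m : ℕ) :
    (prodLaw (iidPMF P m) (iidPMF Q m)).map (Equiv.arrowProdEquivProdArrow (Fin m) (fun _ => α) (fun _ => β)).symm =
      iidPMF (prodLaw P Q) m := by
  ext u
  rw [pmf_map_equiv_apply, Equiv.symm_symm, Equiv.arrowProdEquivProdArrow_apply, prodLaw_apply, iidPMF_apply',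
    iidPMF_apply', iidPMF_apply', ← Finset.prod_mul_distrib]
  exact Finset.prod_congr rfl fun j _ => (prodLaw_apply' P Q (u j)).symm

/-- **Independent trials all in `A`**: `Pr[∀ r, vᵣ ∈ A] = Pr[A]^R` under `p^{⊗R}`. [folklore] -/
theorem toOuterMeasure_iidPMF_forall (p : PMF α) (A : Set α) :
    ∀ R : ℕ, (iidPMF p R).toOuterMeasure {v | ∀ r, v r ∈ A} = p.toOuterMeasure A ^ R
  | 0 => by
    rw [pow_zero, iidPMF_zero, PMF.toOuterMeasure_pure_apply, if_pos]
    exact fun r => r.elim0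
  | R + 1 => by
    classical
    rw [iidPMF_succ, PMF.toOuterMeasure_bind_apply, pow_succ', ← toOuterMeasure_iidPMF_forall p A R]
    conv_rhs => rw [PMF.toOuterMeasure_apply p A, ← ENNReal.tsum_mul_right]
    refine tsum_congr fun x => ?_
    rw [PMF.toOuterMeasure_map_apply]
    by_cases hx : x ∈ A
    · rw [Set.indicator_of_mem hx]
      congr 2
      ext w
      simp only [Set.mem_preimage, Set.mem_setOf_eq, Fin.forall_fin_succ, Fin.cons_zero, Fin.cons_succ]
      exact ⟨fun h => h.2, fun h => ⟨hx, h⟩⟩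
    · rw [Set.indicator_of_notMem hx, zero_mul]
      convert mul_zero (p x)
      rw [← MeasureTheory.measure_empty (μ := (iidPMF p R).toOuterMeasure)]
      congr 1
      ext w
      simp only [Set.mem_preimage, Set.mem_setOf_eq, Set.mem_empty_iff_false, iff_false, not_forall]
      exact ⟨0, by simpa using hx⟩

end Tuples

/-! ### Uniform laws -/

section Uniform

variable {α β : Type} [Fintype α] [Fintype β] [Nonempty α] [Nonempty β]

/-- An independent pair of uniform variables is uniform on the product. [folklore] -/
theorem prodLaw_uniformOfFintype :
    prodLaw (PMF.uniformOfFintype α) (PMF.uniformOfFintype β) = PMF.uniformOfFintype (α × β) := by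
  ext ⟨a, b⟩
  rw [prodLaw_apply, PMF.uniformOfFintype_apply, PMF.uniformOfFintype_apply, PMF.uniformOfFintype_apply,
    Fintype.card_prod, Nat.cast_mul,
    ENNReal.mul_inv (Or.inr (ENNReal.natCast_ne_top _)) (Or.inl (ENNReal.natCast_ne_top _))]

/-- The first coordinate of a uniform pair is uniform. [folklore] -/
theorem uniformOfFintype_map_fst : (PMF.uniformOfFintype (α × β)).map Prod.fst = PMF.uniformOfFintype α := by
  rw [← prodLaw_uniformOfFintype, prodLaw_map_fst]

/-- The second coordinate of a uniform pair is uniform. [folklore] -/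
theorem uniformOfFintype_map_snd : (PMF.uniformOfFintype (α × β)).map Prod.snd = PMF.uniformOfFintype β := by
  rw [← prodLaw_uniformOfFintype, prodLaw_map_snd]

omit [Fintype β] [Nonempty β] in
/-- **A coordinate of a uniform vector is uniform**: `(U_{ι → α}).map (· i₀) = U_α`. [folklore] -/
theorem uniformOfFintype_pi_map_eval {ι : Type} [Fintype ι] [DecidableEq ι] (i₀ : ι) :
    (PMF.uniformOfFintype (ι → α)).map (fun a => a i₀) = PMF.uniformOfFintype α := by
  let e := Equiv.funSplitAt i₀ α
  rw [show (fun a : ι → α => a i₀) = Prod.fst ∘ e from funext fun a => rfl, ← PMF.map_comp,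
    uniformOfFintype_map_of_bijective e.bijective, uniformOfFintype_map_fst]

end Uniform

/-- **A coordinate of the `a`-part of an LWE sample is uniform in `ℤ_q`**: for `(a, b) ← A_{s,χ}`,
`a_{i₀}` is uniform (the `a` "chosen uniformly from `ℤ_pⁿ`", Regev 2009, §2). [cite: RegevLWE2009, §2] -/
theorem lweSample_map_fst_eval {ι R : Type} [Fintype ι] [DecidableEq ι] [CommRing R] [Fintype R]
    (χ : PMF R) (s : ι → R) (i₀ : ι) :
    (lweSample χ s).map (fun x => x.1 i₀) = PMF.uniformOfFintype R := by
  rw [show (fun x : (ι → R) × R => x.1 i₀) = (fun a : ι → R => a i₀) ∘ Prod.fst from rfl, ← PMF.map_comp,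
    lweSample_map_fst_eq, uniformOfFintype_pi_map_eval]

end LWE

end Literature.Computability.Cryptography

end
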